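import Mathlib.Analysis.SpecialFunctions.Log.NegMulLog
import Mathlib.MeasureTheory.Integral.Bochner.Basic
import Literature.Combinatorics.Additive.PFR.FiniteRange
import Literature.Combinatorics.Additive.PFR.MathlibExtras
import Mathlib.MeasureTheory.Measure.Real
import Mathlib.Probability.IdentDistrib
import HarnessLib

/-!
# PFR support: entropy and mutual information of finitely supported measures; uniform random variables

Topic `Literature/Combinatorics/Additive` — supporting library for the polynomial Freiman–Ruzsa theorem
(`Literature.Combinatorics.Additive.polynomialFreimanRuzsa`, Gowers–Green–Manners–Tao 2025).

**Provenance.** This file is a mechanical port of part of the public Lean formalisation of PFR,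
`teorth/pfr` (https://github.com/teorth/pfr), commit `85d5879ae144` ("Bump to v4.32.0", Mathlib
`81a5d257` = this tree's Mathlib), files:
* `PFR/ForMathlib/Entropy/Measure.lean`
* `PFR/ForMathlib/Uniform.lean`
Copyright (c) 2023–2026 the PFR project contributors (T. Tao et al.); released under the Apache License 2.0;
see the upstream repository for the list of authors of each file. Changes made here (D-0022 layout):
upstream `module`/`public section` markers removed; declarations moved under
`namespace Literature.Combinatorics.Additive.PFR`: upstream `namespace ProbabilityTheory` content and root-level
content directly; upstream blocks `namespace X.Y` over a Mathlib namespace are kept textually (so that upstream's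
name resolution inside them is unchanged) but every declaration in them that is NOT a generalized-field-notation
extension is renamed into `Literature.Combinatorics.Additive.PFR` (kernel lemmas into `….PFR.Kernel`); what stays
in a Mathlib namespace are exactly the dot-notation extensions of Mathlib structures/predicates — a lemma `T.foo`
with an explicit argument (or result) of type `T …` for `T` among `IndepFun`, `iIndepFun`, `IdentDistrib`, `Kernel`,
`Measure`, `MeasurePreserving`, `ProbabilityMeasure`, `Set`, … — which keep the true Mathlib name `<ns>.T.foo` so that
upstream's `h.foo` / `.foo` call syntax elaborates (CONVENTIONS §2, deliberate dot-notation extensions). Exact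
duplicates of Mathlib lemmas noticed in review are dropped in favour of Mathlib's; every declaration got a
docstring with a provenance tag. Upstream's global attribute edits on Mathlib declarations (e.g.
`attribute [symm] ProbabilityTheory.IdentDistrib.symm`, `attribute [mk_iff] ProbabilityTheory.IdentDistrib`) are
kept as upstream has them. Statements and proofs are otherwise verbatim.

-/

namespace Literature.Combinatorics.Additive.PFR
end Literature.Combinatorics.Additive.PFR
open Literature.Combinatorics.Additive.PFR

/-! ## Port of `PFR/ForMathlib/Entropy/Measure.lean` -/
section PFR_ForMathlib_Entropy_Measure
/-!
# Entropy of a measure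

## Main definitions

* `measureEntropy`: entropy of a measure `μ`, denoted by `Hm[μ]`
* `measureMutualInfo`: mutual information of a measure over a product space, denoted by `Im[μ]`,
  equal to `Hm[μ.map Prod.fst] + Hm[μ.map Prod.snd] - Hm[μ]`

## Notations

* `Hm[μ] = measureEntropy μ`
* `Im[μ] = measureMutualInfo μ`

-/

open MeasureTheory Real Set
open scoped ENNReal NNReal Topology

namespace Literature.Combinatorics.Additive.PFR
open scoped ProbabilityTheory
open ProbabilityTheory
variable {Ω S T U : Type*} [mΩ : MeasurableSpace Ω]
  [MeasurableSpace S] --[MeasurableSingletonClass S]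
  [MeasurableSpace T] --[MeasurableSingletonClass T]
  [MeasurableSpace U] --[MeasurableSingletonClass U]

section measureEntropy
variable {μ : Measure S}

/-- Entropy of a measure on a measurable space.

We normalize the measure by `(μ Set.univ)⁻¹` to extend the entropy definition to finite measures.
What we really want to do is deal with `μ=0` or `IsProbabilityMeasure μ`, but we don't have
a typeclass for that (we could create one though).
The added complexity ∈ the expression is not an issue because if `μ` is a probability measure,
a call to `simp` will simplify `(μ Set.univ)⁻¹ • μ` to `μ`. [folklore] -/
noncomputable
def measureEntropy (μ : Measure S := by volume_tac) : ℝ :=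
  ∑' s, negMulLog (((μ Set.univ)⁻¹ • μ).real {s})

@[inherit_doc measureEntropy] notation:100 "Hm[" μ "]" => measureEntropy μ

/-- A measure has finite support if there exists a finite set whose complement has zero measure. [folklore] -/
class FiniteSupport (μ : Measure S := by volume_tac) : Prop where
  finite : ∃ A : Finset S, ∀ᵐ x ∂μ, x ∈ A

open MeasureTheory.Measure in
/-- A set on which a measure with finite support is supported. [folklore] -/
noncomputable
def _root_.MeasureTheory.Measure.support (μ : Measure S) [hμ : FiniteSupport μ] : Finset S :=
  hμ.finite.choose.filter (μ {·} ≠ 0)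

/-- `measure_compl_support`: ported from PFR (`PFR/ForMathlib/Entropy/Measure.lean`). [folklore] -/
lemma measure_compl_support (μ : Measure S) [hμ : FiniteSupport μ] : μ μ.supportᶜ = 0 := by
  let A := hμ.finite.choose
  have : (μ.support : Set S)ᶜ ⊆ (A : Set S)ᶜ ∪ ⋃ x ∈ A.filter (μ {·} = 0), {x} := by
    intro z hz
    simp only [Measure.support, ne_eq, Finset.coe_filter, mem_compl_iff, mem_setOf_eq, not_and,
      Decidable.not_not] at hz
    by_cases h'z : z ∈ A
    · simp [hz h'z, h'z]
    · simp [h'z]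
  apply le_antisymm ?_ bot_le
  calc μ (μ.support : Set S)ᶜ ≤ μ ((A : Set S)ᶜ ∪ ⋃ x ∈ A.filter (μ {·} = 0), {x}) :=
    measure_mono this
  _ ≤ μ (Aᶜ) + ∑ x ∈ A.filter (μ {·} = 0), μ {x} := by
    apply (measure_union_le _ _).trans
    gcongr
    apply measure_biUnion_finset_le
  _ ≤ 0 + ∑ x ∈ A.filter (μ {·} = 0), 0 := by
    gcongr with x hx
    · exact hμ.finite.choose_spec.le
    · simp only [Finset.mem_filter] at hx
      exact hx.2.le
  _ = 0 := by simp

/-- `ae_mem_support`: ported from PFR (`PFR/ForMathlib/Entropy/Measure.lean`). [folklore] -/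
lemma ae_mem_support (μ : Measure S) [FiniteSupport μ] : ∀ᵐ x ∂μ, x ∈ μ.support :=
  measure_compl_support _

/-- `mem_support`: ported from PFR (`PFR/ForMathlib/Entropy/Measure.lean`). [folklore] -/
@[simp] lemma mem_support {μ : Measure S} [hμ : FiniteSupport μ] {x : S} :
    x ∈ μ.support ↔ μ {x} ≠ 0 := by
  refine ⟨fun h ↦ ?_, fun h ↦ ?_⟩
  · simp only [Measure.support, ne_eq, Finset.mem_filter] at h
    exact h.2
  · contrapose! h
    exact measure_mono_null (by simpa using h) (measure_compl_support μ)

/-- `finiteSupport_zero`: ported from PFR (`PFR/ForMathlib/Entropy/Measure.lean`). [folklore] -/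
instance finiteSupport_zero : FiniteSupport (0 : Measure S) where
  finite := ⟨(∅ : Finset S), by simp⟩

/-- TODO: replace FiniteSupport hypotheses ∈ these files with FiniteEntropy hypotheses. [folklore] -/
noncomputable def FiniteEntropy (μ : Measure S := by volume_tac) : Prop :=
  Summable (fun s ↦ negMulLog (((μ Set.univ)⁻¹ • μ) {s}).toReal) ∧
  ∃ A : Set S, Countable A ∧ μ Aᶜ = 0

/-- `finiteSupport_of_fintype`: ported from PFR (`PFR/ForMathlib/Entropy/Measure.lean`). [folklore] -/
instance finiteSupport_of_fintype {μ : Measure S} [Finite S] : FiniteSupport μ := by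
  cases nonempty_fintype S
  use Finset.univ
  simp

/-- `finiteSupport_of_mul`: ported from PFR (`PFR/ForMathlib/Entropy/Measure.lean`). [folklore] -/
instance finiteSupport_of_mul {μ : Measure S} [FiniteSupport μ] (c : ℝ≥0∞) :
    FiniteSupport (c • μ) := ⟨μ.support, Measure.ae_smul_measure (ae_mem_support _) _⟩

section

variable [MeasurableSingletonClass S]

/-- `finiteSupport_of_comp`: ported from PFR (`PFR/ForMathlib/Entropy/Measure.lean`). [folklore] -/
lemma finiteSupport_of_comp
    {μ : Measure Ω} [FiniteSupport μ] {X : Ω → S} (hX : Measurable X) :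
    FiniteSupport (μ.map X) := by
  classical
  use Finset.image X μ.support
  rw [ae_map_iff hX.aemeasurable (by exact (Finset.finite_toSet _).measurableSet)]
  filter_upwards [ae_mem_support _] using fun _ ↦ Finset.mem_image_of_mem _

/-- `finiteSupport_of_dirac`: ported from PFR (`PFR/ForMathlib/Entropy/Measure.lean`). [folklore] -/
instance finiteSupport_of_dirac (x : S) : FiniteSupport (Measure.dirac x) := ⟨{x}, by simp⟩

/-- duplicate of `FiniteRange.null_of_compl` [folklore] -/
lemma full_measure_of_finiteRange {μ : Measure Ω} {X : Ω → S}
    (hX : Measurable X) [hX' : FiniteRange X] :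
    (μ.map X) hX'.toFinsetᶜ = 0 := by
  rw [Measure.map_apply hX (MeasurableSet.compl (Finset.measurableSet _))]
  convert measure_empty (μ := μ)
  ext x
  simp [FiniteRange.toFinset]

/-- `ae_mem_of_finiteRange`: ported from PFR (`PFR/ForMathlib/Entropy/Measure.lean`). [folklore] -/
lemma ae_mem_of_finiteRange {μ : Measure Ω} {X : Ω → S} (hX : Measurable X) [hX' : FiniteRange X] :
    ∀ᵐ x ∂μ.map X, x ∈ hX'.toFinset := full_measure_of_finiteRange hX

/-- `finiteSupport_of_finiteRange`: ported from PFR (`PFR/ForMathlib/Entropy/Measure.lean`). [folklore] -/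
instance finiteSupport_of_finiteRange {μ : Measure Ω} {X : Ω → S} [hX' : FiniteRange X] :
    FiniteSupport (μ.map X) := by
  use hX'.toFinset
  exact FiniteRange.null_of_compl μ X

/-- `finiteSupport_of_prod`: ported from PFR (`PFR/ForMathlib/Entropy/Measure.lean`). [folklore] -/
instance finiteSupport_of_prod {μ : Measure S} [FiniteSupport μ] {ν : Measure T} [SigmaFinite ν]
    [FiniteSupport ν] :
    FiniteSupport (μ.prod ν) := by
  use μ.support ×ˢ ν.support
  exact prod_of_full_measure_finset (measure_compl_support μ) (measure_compl_support ν)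

/-- The countability hypothesis can probably be dropped here. Proof is unwieldy and can probably
be golfed. [folklore] -/
lemma integrable_of_finiteSupport (μ : Measure S) [FiniteSupport μ]
    {β : Type*} [NormedAddCommGroup β] [IsFiniteMeasure μ] [Countable S]
    {f : S → β} :
    Integrable f μ := by
  let A := μ.support
  have hA : μ Aᶜ = 0 := measure_compl_support μ
  by_cases hA' : A = ∅
  · simp only [hA', Finset.coe_empty, compl_empty, Measure.measure_univ_eq_zero] at hA
    rw [hA]
    exact integrable_zero_measure
  have : ∃ s₀, s₀ ∈ A := by
    contrapose! hA'
    ext s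
    simpa using hA' s
  rcases this with ⟨s₀, hs₀⟩
  let f' : A → β := fun a ↦ f a
  classical
  let g : S → A := fun s ↦ if h : s ∈ A then ⟨s, h⟩ else ⟨s₀, hs₀⟩
  have : (f' ∘ g) =ᵐ[μ] f := by
    apply Filter.eventuallyEq_of_mem (s := A) hA
    intro a ha
    simp at ha
    simp [f', g, ha]
  apply Integrable.congr _ this
  apply Integrable.comp_measurable .of_finite
  fun_prop

/-- `integral_congr_finiteSupport`: ported from PFR (`PFR/ForMathlib/Entropy/Measure.lean`). [folklore] -/
lemma integral_congr_finiteSupport {μ : Measure Ω} {G : Type*}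
    [NormedAddCommGroup G] [NormedSpace ℝ G] {f g : Ω → G} [FiniteSupport μ]
    (hfg : ∀ x, μ {x} ≠ 0 → f x = g x) : ∫ x, f x ∂μ = ∫ x, g x ∂μ := by
  refine integral_congr_ae <| measure_mono_null ?_ <| measure_compl_support μ
  exact fun x hx hx' ↦ hx <| hfg _ <| mem_support.1 hx'

/-- This generalizes Measure.ext_iff_singleton ∈ MeasureReal [folklore] -/
theorem ext_iff_singleton_finiteSupport
    {μ1 μ2 : Measure S} [FiniteSupport μ1] [FiniteSupport μ2] :
    μ1 = μ2 ↔ ∀ x, μ1 {x} = μ2 {x} := by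
  classical
  constructor
  · rintro rfl
    simp
  · let A1 := μ1.support
    have hA1 := measure_compl_support μ1
    let A2 := μ2.support
    have hA2 := measure_compl_support μ2
    intro h
    ext s
    have h1 : μ1 s = μ1 (s ∩ (A1 ∪ A2)) := by
      apply (measure_eq_measure_of_null_sdiff _ _).symm
      · simp
      refine measure_mono_null ?_ hA1
      intro x
      simp (config := { contextual := true }) [A1]
    have h2 : μ2 s = μ2 (s ∩ (A1 ∪ A2)) := by
      apply (measure_eq_measure_of_null_sdiff _ _).symm
      · simp
      exact measure_mono_null (fun x ↦ by simp (config := { contextual := true }) [A2]) hA2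
    rw [h1, h2]
    have hs : Set.Finite (s ∩ (A1 ∪ A2)) := Set.toFinite (s ∩ (↑A1 ∪ ↑A2))
    rw [← hs.coe_toFinset, ← sum_measure_singleton (μ := μ1), ← sum_measure_singleton (μ := μ2)]
    simp_rw [h]

/-- `ext_iff_measureReal_singleton_finiteSupport`: ported from PFR (`PFR/ForMathlib/Entropy/Measure.lean`). [folklore] -/
theorem ext_iff_measureReal_singleton_finiteSupport {μ1 μ2 : Measure S}
    [FiniteSupport μ1] [FiniteSupport μ2] [IsFiniteMeasure μ1] [IsFiniteMeasure μ2] :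
    μ1 = μ2 ↔ ∀ x, μ1.real {x} = μ2.real {x} := by
  rw [ext_iff_singleton_finiteSupport]
  congr! with x
  have h1 : μ1 {x} ≠ ⊤ := by finiteness
  have h2 : μ2 {x} ≠ ⊤ := by finiteness
  rw [measureReal_def, measureReal_def, ENNReal.toReal_eq_toReal_iff]
  simp [h1, h2]

end

/-- `measureEntropy_eq_sum`: ported from PFR (`PFR/ForMathlib/Entropy/Measure.lean`). [folklore] -/
lemma measureEntropy_eq_sum {μ : Measure S} {A : Finset S} (hA : μ Aᶜ = 0) :
   Hm[μ] = ∑ s ∈ A, negMulLog (((μ Set.univ)⁻¹ • μ).real {s}) := by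
  unfold measureEntropy
  rw [tsum_eq_sum]
  intro s hs
  suffices μ.real {s} = 0 by simp [this]
  rw [Measure.real, measure_mono_null (by simpa) hA]
  simp

/-- `measureEntropy_zero`: ported from PFR (`PFR/ForMathlib/Entropy/Measure.lean`). [folklore] -/
@[simp]
lemma measureEntropy_zero : Hm[(0 : Measure S)] = 0 := by simp [measureEntropy]

/-- `measureEntropy_dirac`: ported from PFR (`PFR/ForMathlib/Entropy/Measure.lean`). [folklore] -/
@[simp]
lemma measureEntropy_dirac [MeasurableSingletonClass S] (x : S) : Hm[Measure.dirac x] = 0 := by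
  rw [measureEntropy]
  simp only [MeasurableSet.univ, Measure.dirac_apply', mem_univ, indicator_of_mem, Pi.one_apply,
    inv_one, one_smul]
  rw [tsum_eq_single x]
  · simp only [Measure.real, MeasurableSet.singleton, Measure.dirac_apply', mem_singleton_iff,
    indicator_of_mem, Pi.one_apply, ENNReal.toReal_one, negMulLog_one]
  · simp +contextual [eq_comm]

/-- `measureEntropy_of_not_isFiniteMeasure`: ported from PFR (`PFR/ForMathlib/Entropy/Measure.lean`). [folklore] -/
lemma measureEntropy_of_not_isFiniteMeasure (h : ¬ IsFiniteMeasure μ) : Hm[μ] = 0 := by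
  simp [measureEntropy, not_isFiniteMeasure_iff.mp h]

/-- `measureEntropy_of_isProbabilityMeasure`: ported from PFR (`PFR/ForMathlib/Entropy/Measure.lean`). [folklore] -/
lemma measureEntropy_of_isProbabilityMeasure (μ : Measure S) [IsZeroOrProbabilityMeasure μ] :
    Hm[μ] = ∑' s, negMulLog (μ.real {s}) := by
  rcases eq_zero_or_isProbabilityMeasure μ with rfl | hμ
  · simp [measureEntropy]
  · simp [measureEntropy]

/-- `measureEntropy_of_isProbabilityMeasure'`: ported from PFR (`PFR/ForMathlib/Entropy/Measure.lean`). [folklore] -/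
lemma measureEntropy_of_isProbabilityMeasure' (μ : Measure S) [IsZeroOrProbabilityMeasure μ] :
    Hm[μ] = ∑' s, negMulLog (μ.real {s}) :=
  measureEntropy_of_isProbabilityMeasure μ

/-- `measureEntropy_of_isProbabilityMeasure_finite`: ported from PFR (`PFR/ForMathlib/Entropy/Measure.lean`). [folklore] -/
lemma measureEntropy_of_isProbabilityMeasure_finite {μ : Measure S} {A : Finset S} (hA : μ Aᶜ = 0)
    [IsZeroOrProbabilityMeasure μ] :
    Hm[μ] = ∑ s ∈ A, negMulLog (μ.real {s}) := by
  rw [measureEntropy_eq_sum hA]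
  rcases eq_zero_or_isProbabilityMeasure μ with rfl | hμ <;> simp

/-- `measureEntropy_of_isProbabilityMeasure_finite'`: ported from PFR (`PFR/ForMathlib/Entropy/Measure.lean`). [folklore] -/
lemma measureEntropy_of_isProbabilityMeasure_finite' {μ : Measure S} {A : Finset S} (hA : μ Aᶜ = 0)
    [IsZeroOrProbabilityMeasure μ] :
    Hm[μ] = ∑ s ∈ A, negMulLog (μ.real {s}) :=
  measureEntropy_of_isProbabilityMeasure_finite hA

/-- `measureEntropy_univ_smul`: ported from PFR (`PFR/ForMathlib/Entropy/Measure.lean`). [folklore] -/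
lemma measureEntropy_univ_smul : Hm[(μ Set.univ)⁻¹ • μ] = Hm[μ] := by
  by_cases hμ_fin : IsFiniteMeasure μ
  swap
  · rw [measureEntropy_of_not_isFiniteMeasure hμ_fin]
    rw [not_isFiniteMeasure_iff] at hμ_fin
    simp [hμ_fin]
  cases eq_zero_or_neZero μ with
  | inl hμ => simp [hμ]
  | inr hμ => simp [measureEntropy]

/-- `measureEntropy_nonneg`: ported from PFR (`PFR/ForMathlib/Entropy/Measure.lean`). [folklore] -/
lemma measureEntropy_nonneg (μ : Measure S) : 0 ≤ Hm[μ] := by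
  by_cases hμ_fin : IsFiniteMeasure μ
  swap; · rw [measureEntropy_of_not_isFiniteMeasure hμ_fin]
  apply tsum_nonneg
  intro s
  apply negMulLog_nonneg (by positivity)
  refine ENNReal.toReal_le_of_le_ofReal zero_le_one ?_
  rw [ENNReal.ofReal_one]
  cases eq_zero_or_neZero μ with
  | inl hμ => simp [hμ]
  | inr hμ => exact prob_le_one

variable [MeasurableSingletonClass S]

/-- Auxiliary lemma for `measureEntropy_le_log_card_of_mem`, which removes the probability
measure assumption. [folklore] -/
lemma measureEntropy_le_card_aux {μ : Measure S} [IsProbabilityMeasure μ]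
    (A : Finset S) (hμ : μ Aᶜ = 0) :
    Hm[μ] ≤ log A.card := by
  have μA : μ A = 1 := by
    rw [← compl_compl (A : Set S), measure_compl A.measurableSet.compl (measure_ne_top _ _), hμ]
    simp
  let N := A.card
  have N_pos : (0 : ℝ) < N := by
    rcases Finset.eq_empty_or_nonempty A with rfl|hA
    · simp at μA
    · simpa [N] using Finset.card_pos.mpr hA
  simp only [measureEntropy, measure_univ, inv_one, one_smul]
  calc
  ∑' x, negMulLog (μ.real {x})
    = ∑ x ∈ A, negMulLog (μ.real {x}) := by
      apply tsum_eq_sum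
      intro i hi
      have : μ {i} = 0 :=
        le_antisymm ((measure_mono (by simpa using hi)).trans (le_of_eq hμ)) bot_le
      simp [Measure.real, this]
  _ = N * ∑ x ∈ A, (N : ℝ)⁻¹ * negMulLog (μ.real {x}) := by
      rw [Finset.mul_sum]
      congr with x
      rw [← mul_assoc, mul_inv_cancel₀, one_mul]
      exact N_pos.ne'
  _ ≤ N * negMulLog (∑ x ∈ A, (N : ℝ)⁻¹ * (μ.real {x})) := by
      gcongr
      exact concaveOn_negMulLog.le_map_sum (by simp) (by simp [mul_inv_cancel₀ N_pos.ne', N])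
        (by simp)
  _ = N * negMulLog ((N : ℝ)⁻¹) := by simp [← Finset.mul_sum]; simp [μA, Measure.real]
  _ = log A.card := by simp [negMulLog, ← mul_assoc, mul_inv_cancel₀ N_pos.ne', N]

/-- `measureEntropy_eq_card_iff_measureReal_eq_aux`: ported from PFR (`PFR/ForMathlib/Entropy/Measure.lean`). [folklore] -/
lemma measureEntropy_eq_card_iff_measureReal_eq_aux [Fintype S]
    (μ : Measure S) [IsProbabilityMeasure μ] :
    Hm[μ] = log (Fintype.card S) ↔ ∀ s, μ.real {s} = (Fintype.card S : ℝ)⁻¹ := by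
  cases isEmpty_or_nonempty S
  · simp [Fintype.card_eq_zero, Subsingleton.elim μ 0]
  -- multiply LHS equation through by `N⁻¹`
  set N := Fintype.card S
  have hN : (N:ℝ)⁻¹ ≠ 0 := by positivity
  rw [← mul_right_inj' hN]
  -- setup to use equality case of Jensen
  let w (_ : S) := (N:ℝ)⁻¹
  have hw1 : ∀ s ∈ Finset.univ, 0 < w s := by intros; positivity
  have hw2 : ∑ s : S, w s = 1 := by simp [w, Finset.card_univ, N]
  let p (s : S) := μ.real {s}
  have hp : ∀ s ∈ Finset.univ, 0 ≤ p s := by intros; positivity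
  rw [measureEntropy, tsum_fintype, eq_comm]
  convert strictConcaveOn_negMulLog.map_sum_eq_iff hw1 hw2 hp using 2
  · simp [w, p, negMulLog, ← Finset.mul_sum]
  · simp [Finset.mul_sum, w, p]
  · simp [p, ← Finset.mul_sum, w, p]

/-- `measureEntropy_eq_card_iff_measure_eq_aux`: ported from PFR (`PFR/ForMathlib/Entropy/Measure.lean`). [folklore] -/
lemma measureEntropy_eq_card_iff_measure_eq_aux
    (μ : Measure S) [Fintype S] [IsProbabilityMeasure μ] :
    Hm[μ] = log (Fintype.card S) ↔ (∀ s : S, μ {s} = (Fintype.card S : ℝ≥0)⁻¹) := by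
  rw [measureEntropy_eq_card_iff_measureReal_eq_aux]
  congr! with s
  rw [measureReal_def, ← ENNReal.toReal_eq_toReal_iff' (measure_ne_top μ {s}) (by simp)]
  congr!

/-- `measureEntropy_le_log_card_of_mem`: ported from PFR (`PFR/ForMathlib/Entropy/Measure.lean`). [folklore] -/
lemma measureEntropy_le_log_card_of_mem
    {A : Finset S} (μ : Measure S) (hμA : μ Aᶜ = 0) :
    Hm[μ] ≤ log A.card := by
  have h_log_card_nonneg : 0 ≤ log (Nat.card A) := log_natCast_nonneg (Nat.card ↑A)
  rcases eq_zero_or_neZero μ with rfl|hμ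
  · simp
    positivity
  by_cases hμ_fin : IsFiniteMeasure μ
  · rw [← measureEntropy_univ_smul]
    exact measureEntropy_le_card_aux A <| by simp [hμA]
  · rw [measureEntropy_of_not_isFiniteMeasure hμ_fin]
    exact log_natCast_nonneg _

/-- `measureEntropy_le_log_card`: ported from PFR (`PFR/ForMathlib/Entropy/Measure.lean`). [folklore] -/
lemma measureEntropy_le_log_card [Fintype S] (μ : Measure S) : Hm[μ] ≤ log (Fintype.card S) :=
  measureEntropy_le_log_card_of_mem (A := (Finset.univ : Finset S)) μ (by simp)

/-- `measureEntropy_eq_card_iff_measureReal_eq`: ported from PFR (`PFR/ForMathlib/Entropy/Measure.lean`). [folklore] -/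
lemma measureEntropy_eq_card_iff_measureReal_eq [Fintype S] [IsFiniteMeasure μ] [NeZero μ] :
    Hm[μ] = log (Fintype.card S) ↔ ∀ s : S, μ.real {s} = μ.real Set.univ / Fintype.card S := by
  rw [← measureEntropy_univ_smul]
  convert measureEntropy_eq_card_iff_measureReal_eq_aux ((μ Set.univ)⁻¹ • μ) using 2 with s
  simp only [measureReal_ennreal_smul_apply]
  rw [ENNReal.toReal_inv, inv_mul_eq_iff_eq_mul₀ (by exact measureReal_univ_ne_zero),
    div_eq_mul_inv]
  rfl

/-- The entropy of a uniform measure is the log of the cardinality of its support. [folklore] -/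
lemma entropy_of_uniformOn (H : Set S) [Nonempty H] [Finite H] :
    measureEntropy (uniformOn H) = log (Nat.card H) := by
  simp only [measureEntropy, measure_univ, inv_one, one_smul, Set.toFinite, uniformOn_real]
  classical
  calc ∑' s, negMulLog ((Nat.card (H ∩ {s} : Set S)) / Nat.card H)
    _ = ∑' s, if s ∈ H then negMulLog (1 / Nat.card H) else 0 := by
      congr with s; by_cases h : s ∈ H <;> simp [h]
    _ = ∑ s ∈ H.toFinite.toFinset, negMulLog (1 / Nat.card H) := by
      convert tsum_eq_sum (s := H.toFinite.toFinset) ?_ using 2 with s hs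
      · simp at hs; simp [hs]
      · constructor
        simp
      intro s hs
      simp only [Set.Finite.mem_toFinset] at hs; simp [hs]
    _ = (Nat.card H) * negMulLog (1 / Nat.card H) := by simp [← Set.ncard_coe_finset]
    _ = log (Nat.card H) := by
      simp only [negMulLog, one_div, log_inv, mul_neg, neg_mul, neg_neg, ← mul_assoc]
      rw [mul_inv_cancel₀, one_mul]
      simp only [ne_eq, Nat.cast_eq_zero, Nat.card_ne_zero]
      exact ⟨‹_›, ‹_›⟩

/-- `measureEntropy_eq_card_iff_measure_eq`: ported from PFR (`PFR/ForMathlib/Entropy/Measure.lean`). [folklore] -/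
lemma measureEntropy_eq_card_iff_measure_eq [Fintype S] [IsFiniteMeasure μ] [NeZero μ] :
    Hm[μ] = log (Fintype.card S) ↔
    (∀ s : S, μ {s} = μ Set.univ / Fintype.card S) := by
  obtain h | h := isEmpty_or_nonempty S
  · have : μ = 0 := Subsingleton.elim _ _
    simp [Fintype.card_eq_zero, this]
  rw [div_eq_mul_inv, measureEntropy_eq_card_iff_measureReal_eq]
  congr! with s
  rw [measureReal_def, ← ENNReal.toReal_eq_toReal_iff' (measure_ne_top μ {s})]
  · rw [ENNReal.toReal_mul, ENNReal.toReal_inv]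
    rfl
  · finiteness

/-- `measureEntropy_map_of_injective`: ported from PFR (`PFR/ForMathlib/Entropy/Measure.lean`). [folklore] -/
lemma measureEntropy_map_of_injective
    (μ : Measure T) (f : T → S) (hf_m : Measurable f) (hf : Function.Injective f) :
    Hm[μ.map f] = Hm[μ] := by
  have : μ.map f Set.univ = μ Set.univ := by
      rw [Measure.map_apply hf_m MeasurableSet.univ]
      simp
  simp_rw [measureEntropy, Measure.ennreal_smul_real_apply,
    map_measureReal_apply hf_m (.singleton _)]
  rw [this]
  classical
  let F (x : S) : ℝ := negMulLog ((μ Set.univ)⁻¹.toReal • μ.real (f ⁻¹' {x}))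
  have : ∑' x : S, F x
      = ∑' x : (f '' Set.univ), F x := by
    apply (tsum_subtype_eq_of_support_subset _).symm
    intro x hx
    contrapose hx
    suffices f ⁻¹' {x} = ∅ by simp [F, this]
    contrapose! hx
    rw [Set.image_univ]
    exact hx
  rw [this, tsum_image _ hf.injOn, tsum_univ fun x ↦ F (f x)]
  congr! with s
  ext s'
  simpa using hf.eq_iff

/-- `measureEntropy_comap`: ported from PFR (`PFR/ForMathlib/Entropy/Measure.lean`). [folklore] -/
lemma measureEntropy_comap (μ : Measure T) (f : S → T) (hf : MeasurableEmbedding f)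
    (hf_range : Set.range f =ᵐ[μ] Set.univ) :
    Hm[μ.comap f] = Hm[μ] := by
  simp_rw [measureEntropy, Measure.ennreal_smul_real_apply,
    Measure.comap_real_apply hf.injective hf.measurableSet_image' _ (.singleton _),
    Measure.comap_apply f hf.injective hf.measurableSet_image' _ MeasurableSet.univ]
  simp only [Set.image_univ, Set.image_singleton, smul_eq_mul]
  classical
  rw [← tsum_range (f := fun x ↦ negMulLog ((μ (Set.range f))⁻¹.toReal * μ.real {x})) (g := f)
    hf.injective, measure_congr hf_range ]
  let F (x : T) : ℝ := negMulLog ((μ .univ)⁻¹.toReal * μ.real {x})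
  change ∑' x : (Set.range f), F x = ∑' x : T, F x
  apply tsum_subtype_eq_of_support_subset
  intro x hx
  contrapose hx
  suffices μ {x} = 0 by simp [F, Measure.real, this]
  simp only [ae_eq_univ] at hf_range
  exact measure_mono_null (by simp [*]) hf_range

/-- `measureEntropy_comap_equiv`: ported from PFR (`PFR/ForMathlib/Entropy/Measure.lean`). [folklore] -/
lemma measureEntropy_comap_equiv (μ : Measure T) (f : S ≃ᵐ T) : Hm[μ.comap f] = Hm[μ] := by
  refine measureEntropy_comap μ f f.measurableEmbedding ?_
  simp only [ae_eq_univ]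
  have : Set.range f = Set.univ := Equiv.range_eq_univ _
  simp [this]

/-- An ambitious goal would be to replace FiniteSupport with finite entropy. [folklore] -/
@[simp]
lemma measureEntropy_prod {μ : Measure S} {ν : Measure T} [FiniteSupport μ] [FiniteSupport ν]
    [IsProbabilityMeasure μ] [IsProbabilityMeasure ν] [MeasurableSingletonClass T] :
    Hm[μ.prod ν] = Hm[μ] + Hm[ν] := by
  let A := μ.support
  have hA := measure_compl_support μ
  let B := ν.support
  have hB := measure_compl_support ν
  have hC : (μ.prod ν) (A ×ˢ B : Finset (S × T))ᶜ = 0 := by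
    have : ((A ×ˢ B : Finset (S × T)) : Set (S × T))ᶜ
      = ((A : Set S)ᶜ ×ˢ Set.univ) ∪ (Set.univ ×ˢ (B : Set T)ᶜ) := by ext ⟨a, b⟩; simp; tauto
    rw [this]
    simp [hA, hB, A, B]
  have h1 : Hm[μ] = ∑ p ∈ (A ×ˢ B), (negMulLog (μ.real {p.1})) * (ν.real {p.2}) := by
    rw [measureEntropy_of_isProbabilityMeasure_finite' hA, Finset.sum_product]
    congr with s
    dsimp
    simp only [← Finset.mul_sum, sum_measureReal_singleton]
    suffices ν.real B = ν.real Set.univ by simp at this; simp [this]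
    apply measureReal_congr
    simp [hB, B]
  have h2 : Hm[ν] = ∑ p ∈ (A ×ˢ B), (negMulLog (ν.real {p.2})) * (μ.real {p.1}) := by
    rw [measureEntropy_of_isProbabilityMeasure_finite' hB, Finset.sum_product_right]
    congr with t
    dsimp
    simp only [← Finset.mul_sum, sum_measureReal_singleton]
    suffices μ.real A = μ.real Set.univ by simp at this; simp [this]
    apply measureReal_congr
    simp [hA, A]
  rw [measureEntropy_of_isProbabilityMeasure_finite' hC, h1, h2, ← Finset.sum_add_distrib]
  congr with ⟨s, t⟩
  simp_rw [← Set.singleton_prod_singleton, measureReal_prod_prod, negMulLog_mul]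
  ring

end measureEntropy

section measureMutualInfo

/-- The mutual information between the marginals of a measure on a product space. [folklore] -/
noncomputable
def measureMutualInfo (μ : Measure (S × T) := by volume_tac) : ℝ :=
  Hm[μ.map Prod.fst] + Hm[μ.map Prod.snd] - Hm[μ]

/-- The mutual information between the marginals of a measure on a product space. -/
notation:100 "Im[" μ "]" => measureMutualInfo μ

/-- `measureMutualInfo_def`: ported from PFR (`PFR/ForMathlib/Entropy/Measure.lean`). [folklore] -/
lemma measureMutualInfo_def (μ : Measure (S × T)) :
    Im[μ] = Hm[μ.map Prod.fst] + Hm[μ.map Prod.snd] - Hm[μ] := rfl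

/-- `measureMutualInfo_zero_measure`: ported from PFR (`PFR/ForMathlib/Entropy/Measure.lean`). [folklore] -/
@[simp]
lemma measureMutualInfo_zero_measure : Im[(0 : Measure (S × T))] = 0 := by
  simp [measureMutualInfo]

/-- `measureMutualInfo_of_not_isFiniteMeasure`: ported from PFR (`PFR/ForMathlib/Entropy/Measure.lean`). [folklore] -/
lemma measureMutualInfo_of_not_isFiniteMeasure {μ : Measure (S × U)} (h : ¬ IsFiniteMeasure μ) :
    Im[μ] = 0 := by
  rw [measureMutualInfo_def]
  have h1 : ¬ IsFiniteMeasure (μ.map Prod.fst) := by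
    rw [not_isFiniteMeasure_iff] at h ⊢
    rw [← h]
    exact Measure.map_apply measurable_fst MeasurableSet.univ
  have h2 : ¬ IsFiniteMeasure (μ.map Prod.snd) := by
    rw [not_isFiniteMeasure_iff] at h ⊢
    rw [← h]
    exact Measure.map_apply measurable_snd MeasurableSet.univ
  rw [measureEntropy_of_not_isFiniteMeasure h, measureEntropy_of_not_isFiniteMeasure h1,
    measureEntropy_of_not_isFiniteMeasure h2]
  simp

/-- `measureMutualInfo_univ_smul`: ported from PFR (`PFR/ForMathlib/Entropy/Measure.lean`). [folklore] -/
lemma measureMutualInfo_univ_smul (μ : Measure (S × U)) : Im[(μ Set.univ)⁻¹ • μ] = Im[μ] := by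
  by_cases hμ_fin : IsFiniteMeasure μ
  swap
  · rw [measureMutualInfo_of_not_isFiniteMeasure hμ_fin]
    rw [not_isFiniteMeasure_iff] at hμ_fin
    simp [hμ_fin]
  rcases eq_zero_or_neZero μ with hμ | _
  · simp [hμ]
  rw [measureMutualInfo_def, measureMutualInfo_def]
  congr 1
  · congr 1
    · convert measureEntropy_univ_smul
      simp [Measure.map_smul, Measure.map_apply measurable_fst]
    · convert measureEntropy_univ_smul
      simp [Measure.map_smul, Measure.map_apply measurable_snd]
  convert measureEntropy_univ_smul

variable [MeasurableSingletonClass S] [MeasurableSingletonClass T] [MeasurableSingletonClass U]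

/-- `measureMutualInfo_swap`: ported from PFR (`PFR/ForMathlib/Entropy/Measure.lean`). [folklore] -/
lemma measureMutualInfo_swap (μ : Measure (S × T)) :
    Im[μ.map Prod.swap] = Im[μ] := by
  rw [measureMutualInfo_def, add_comm, Measure.map_map measurable_snd measurable_swap,
    Measure.map_map measurable_fst measurable_swap]
  congr 1
  simp_rw [measureEntropy, Measure.map_apply measurable_swap MeasurableSet.univ]
  simp only [Set.preimage_univ, Measure.ennreal_smul_real_apply, smul_eq_mul]
  simp_rw [map_measureReal_apply measurable_swap (.singleton _)]
  have : Set.range (Prod.swap : S × T → T × S) = .univ := Set.range_eq_univ.mpr Prod.swap_surjective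
  rw [← tsum_univ, ← this,
    tsum_range (fun x ↦ negMulLog <| (μ Set.univ)⁻¹.toReal * μ.real (Prod.swap⁻¹' {x}))
      Prod.swap_injective]
  congr! with ⟨s, t⟩
  simpa using Prod.swap_injective.preimage_image {(s, t)}

/-- `measureMutualInfo_prod`: ported from PFR (`PFR/ForMathlib/Entropy/Measure.lean`). [folklore] -/
@[simp]
lemma measureMutualInfo_prod {μ : Measure S} {ν : Measure T} [FiniteSupport μ] [FiniteSupport ν]
    [IsProbabilityMeasure μ] [IsProbabilityMeasure ν] :
    Im[μ.prod ν] = 0 := by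
  rw [measureMutualInfo_def, measureEntropy_prod]
  simp

/-- An ambitious goal would be to replace FiniteSupport with finite entropy. Proof is long and slow;
needs to be optimized [folklore] -/
lemma measureMutualInfo_nonneg_aux {μ : Measure (S × U)} [FiniteSupport μ]
    [IsZeroOrProbabilityMeasure μ] :
    0 ≤ Im[μ] ∧
    (Im[μ] = 0 ↔ ∀ p, μ.real {p} = (μ.map Prod.fst).real {p.1} * (μ.map Prod.snd).real {p.2}) := by
  rcases eq_zero_or_isProbabilityMeasure μ with rfl | hμ
  · simp
  have : IsProbabilityMeasure (μ.map Prod.fst) :=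
    Measure.isProbabilityMeasure_map measurable_fst.aemeasurable
  have : IsProbabilityMeasure (μ.map Prod.snd) :=
    Measure.isProbabilityMeasure_map measurable_snd.aemeasurable
  let E := μ.support
  have hE := measure_compl_support μ
  classical
  set E1 : Finset S := Finset.image Prod.fst E
  set E2 : Finset U := Finset.image Prod.snd E
  have hE' : μ (E1 ×ˢ E2 : Finset (S × U))ᶜ = 0 := by
    refine measure_mono_null ?_ hE
    intro ⟨s, u⟩
    contrapose!
    intro h
    simp only [mem_compl_iff, SetLike.mem_coe, mem_support, ne_eq, Decidable.not_not,
      Finset.coe_product, mem_prod, not_and, Classical.not_imp] at h ⊢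
    simp only [Finset.mem_image, Prod.exists, exists_and_right, exists_eq_right, E1, E, E2,
      mem_support]
    constructor
    · use u
    · use s
  have hE1 : (μ.map Prod.fst) E1ᶜ = 0 := by
    rw [Measure.map_apply measurable_fst (MeasurableSet.compl (Finset.measurableSet E1))]
    refine measure_mono_null ?_ hE
    intro ⟨s, u⟩
    simp only [preimage_compl, mem_compl_iff, mem_preimage, SetLike.mem_coe, mem_support, ne_eq,
      Decidable.not_not]
    contrapose!
    simp only [Finset.mem_image, Prod.exists, exists_and_right, exists_eq_right, E1, E,
      mem_support]
    intro h; use u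
  have hE1' : (μ.map Prod.fst).real E1 = 1 := by
    rw [prob_compl_eq_zero_iff E1.measurableSet] at hE1
    unfold Measure.real
    rw [hE1]
    norm_num
  have hE2 : (μ.map Prod.snd) E2ᶜ = 0 := by
    rw [Measure.map_apply measurable_snd (MeasurableSet.compl (Finset.measurableSet E2))]
    refine measure_mono_null ?_ hE
    intro ⟨s, u⟩
    simp only [preimage_compl, mem_compl_iff, mem_preimage, SetLike.mem_coe, mem_support, ne_eq,
      Decidable.not_not]
    contrapose!
    simp only [Finset.mem_image, Prod.exists, exists_eq_right, E2, E, mem_support]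
    intro h; use s
  have hE2' : (μ.map Prod.snd).real E2 = 1 := by
    rw [prob_compl_eq_zero_iff E2.measurableSet] at hE2
    unfold Measure.real
    rw [hE2]
    norm_num
  have h_fst_ne_zero : ∀ p, μ.real {p} ≠ 0 → (μ.map Prod.fst).real {p.1} ≠ 0 := by
    intro p hp
    rw [map_measureReal_apply measurable_fst (.singleton _)]
    refine fun h_eq_zero ↦ hp <| measureReal_mono_null (by simp) h_eq_zero
  have h_snd_ne_zero : ∀ p, μ.real {p} ≠ 0 → (μ.map Prod.snd).real {p.2} ≠ 0 := by
    intro p hp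
    rw [map_measureReal_apply measurable_snd (.singleton _)]
    exact fun h_eq_zero ↦ hp <| measureReal_mono_null (by simp) h_eq_zero
  have h1 y : (μ.map Prod.fst).real {y} = ∑ z ∈ E2, μ.real {(y, z)} := by
    rw [map_measureReal_apply measurable_fst (.singleton _), ← measureReal_biUnion_finset]
    · apply measureReal_congr
      rw [MeasureTheory.ae_eq_set]
      constructor
      · refine measure_mono_null ?_ hE
        rintro ⟨s, u⟩ ⟨rfl, h2⟩
        contrapose! h2
        simp only [mem_compl_iff, SetLike.mem_coe, mem_support, ne_eq, Decidable.not_not,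
          Finset.mem_image, Prod.exists, exists_eq_right, iUnion_exists, mem_iUnion,
          mem_singleton_iff, Prod.mk.injEq, true_and, exists_prop, exists_and_right,
          exists_eq_right', E2, E] at h2 ⊢
        use s
      · convert measure_empty (μ := μ)
        simp [Set.sdiff_eq_empty]
    · intro s1 _ s2 _ h; simp [h]
    intros; exact .singleton _
  have h2 z : (μ.map Prod.snd).real {z} = ∑ y ∈ E1, μ.real {(y, z)} := by
    rw [map_measureReal_apply measurable_snd (.singleton _), ← measureReal_biUnion_finset]
    · apply measureReal_congr
      rw [MeasureTheory.ae_eq_set]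
      constructor
      · refine measure_mono_null ?_ hE
        rintro ⟨s, u⟩ ⟨rfl, h2⟩
        contrapose! h2
        simp only [mem_compl_iff, SetLike.mem_coe, mem_support, ne_eq, Decidable.not_not,
          Finset.mem_image, Prod.exists, exists_and_right, exists_eq_right, iUnion_exists,
          mem_iUnion, mem_singleton_iff, Prod.mk.injEq, and_true, exists_prop, exists_eq_right', E1,
          E] at h2 ⊢
        use u
      · convert measure_empty (μ := μ)
        simp [Set.sdiff_eq_empty]
    · intro s1 _ s2 _ h; simp [h]
    intros; exact .singleton _
  let w (p : S × U) := (μ.map Prod.fst).real {p.1} * (μ.map Prod.snd).real {p.2}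
  let f (p : S × U) := ((μ.map Prod.fst).real {p.1} * (μ.map Prod.snd).real {p.2})⁻¹ * μ.real {p}
  have hw1 : ∀ p ∈ (E1 ×ˢ E2), 0 ≤ w p := by intros; positivity
  have hw2 : ∑ p ∈ E1 ×ˢ E2, w p = 1 := by
    rw [Finset.sum_product]
    simp only [← Finset.mul_sum, sum_measureReal_singleton, w]
    rw [← Finset.sum_mul]
    rw [show (1 : ℝ) = 1 * 1 by norm_num]
    congr
    convert hE1'
    simp
  have hf : ∀ p ∈ E1 ×ˢ E2, 0 ≤ f p := by intros; positivity
  have H :=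
  calc
    ∑ p ∈ E1 ×ˢ E2, w p * f p
        = ∑ p ∈ E1 ×ˢ E2, μ.real {p} := by
          congr with p
          by_cases hp : μ.real {p} = 0
          · simp [f, hp]
          · simp [w, f]
            field_simp [h_fst_ne_zero p hp, h_snd_ne_zero p hp]
      _ = 1 := by
        simp only [sum_measureReal_singleton, Finset.coe_product]
        rw [show 1 = μ.real Set.univ by simp]
        apply measureReal_congr
        simpa using hE'
  have H1 : -measureMutualInfo (μ := μ) = ∑ p ∈ E1 ×ˢ E2, w p * negMulLog (f p) := calc
    _ = ∑ p ∈ E1 ×ˢ E2,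
          (-(μ.real {p} * log (μ.real {p}))
          + (μ.real {p} * log ((μ.map Prod.snd).real {p.2})
            + μ.real {p} * log ((μ.map Prod.fst).real {p.1}))) := by
        have H0 : Hm[μ] = -∑ p ∈ E1 ×ˢ E2, μ.real {p} * log (μ.real {p}) := by
          simp_rw [measureEntropy_of_isProbabilityMeasure_finite hE', negMulLog, neg_mul,
            Finset.sum_neg_distrib]
        have H1 : Hm[μ.map Prod.fst] = -∑ p ∈ E1 ×ˢ E2,
            μ.real {p} * log ((μ.map Prod.fst).real {p.1}) := by
          simp_rw [measureEntropy_of_isProbabilityMeasure_finite hE1, negMulLog, neg_mul,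
            Finset.sum_neg_distrib, Finset.sum_product, ← Finset.sum_mul]
          congr! with s _
          exact h1 s
        have H2 : Hm[μ.map Prod.snd] =
            -∑ p ∈ E1 ×ˢ E2, μ.real {p} * log ((μ.map Prod.snd).real {p.2}) := by
          simp_rw [measureEntropy_of_isProbabilityMeasure_finite hE2, negMulLog, neg_mul,
            Finset.sum_neg_distrib, Finset.sum_product_right, ← Finset.sum_mul]
          congr! with s _
          exact h2 s
        simp_rw [measureMutualInfo_def, H0, H1, H2]
        simp [Finset.sum_add_distrib]
    _ = ∑ p ∈ E1 ×ˢ E2, w p * negMulLog (f p) := by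
        congr! 1 with p _
        by_cases hp : μ.real {p} = 0
        · simp [f, hp]
        have := h_fst_ne_zero p hp
        have := h_snd_ne_zero p hp
        simp [negMulLog, log_mul, log_inv, h_fst_ne_zero p hp, h_snd_ne_zero p hp, hp, w, f]
        field_simp
        ring
  have H2 : 0 = negMulLog (∑ s ∈ (E1 ×ˢ E2), w s * f s) := by
    rw [H, negMulLog_one]
  constructor
  · rw [← neg_nonpos, H1, H2]
    exact concaveOn_negMulLog.le_map_sum hw1 hw2 hf
  rw [← neg_eq_zero, H1, H2, eq_comm]
  refine (strictConcaveOn_negMulLog.map_sum_eq_iff' hw1 hw2 hf).trans ?_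
  have w0 (p : S × U) (hp: w p = 0) : μ.real {p} = 0 := by
    simp only [mul_eq_zero, w] at hp
    rcases hp with hp | hp
    · contrapose! hp; exact (h_fst_ne_zero p) hp
    · contrapose! hp; exact (h_snd_ne_zero p) hp
  constructor
  · intro hyp p
    by_cases hp1 : p.1 ∈ E1
    · by_cases hp2 : p.2 ∈ E2
      · have hp : p ∈ E1 ×ˢ E2 := Finset.mem_product.mpr ⟨hp1, hp2⟩
        by_cases hw : w p = 0
        · rw [w0 p hw]
          exact hw.symm
        replace hyp := hyp p hp hw
        simp_rw [smul_eq_mul, H] at hyp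
        have := eq_of_inv_mul_eq_one hyp
        convert this.symm
      have : {p.2} ⊆ (E2 : Set U)ᶜ := by
        simp only [Set.singleton_subset_iff, Set.mem_compl_iff, Finset.mem_coe]; convert hp2
      replace : (Measure.map Prod.snd μ).real {p.2} = 0 := by
        rw [measureReal_eq_zero_iff]; exact measure_mono_null this hE2
      have hp : μ.real {p} = 0 := by contrapose! this; exact (h_snd_ne_zero p) this
      simp [hp, this]
    have : {p.1} ⊆ (E1 : Set S)ᶜ := by
      simp only [Set.singleton_subset_iff, Set.mem_compl_iff, Finset.mem_coe]; convert hp1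
    replace : (Measure.map Prod.fst μ).real {p.1} = 0 := by
      rw [measureReal_eq_zero_iff]; exact measure_mono_null this hE1
    have hp : μ.real {p} = 0 := by contrapose! this; exact (h_fst_ne_zero p) this
    simp [hp, this]
  intro hyp ⟨s, u⟩ _ hw
  simp_rw [smul_eq_mul, H]
  change (w (s,u))⁻¹ * (μ.real {(s,u)}) = 1
  have : w (s,u) ≠ 0 := by exact hw
  field_simp [this]
  rw [hyp (s,u)]

/-- `measureMutualInfo_nonneg`: ported from PFR (`PFR/ForMathlib/Entropy/Measure.lean`). [folklore] -/
lemma measureMutualInfo_nonneg {μ : Measure (S × U)} [FiniteSupport μ] :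
    0 ≤ Im[μ] := by
  by_cases hμ_fin : IsFiniteMeasure μ
  · rw [← measureMutualInfo_univ_smul μ]
    apply measureMutualInfo_nonneg_aux.1
  rw [measureMutualInfo_of_not_isFiniteMeasure hμ_fin]

/-- `measureMutualInfo_eq_zero_iff`: ported from PFR (`PFR/ForMathlib/Entropy/Measure.lean`). [folklore] -/
lemma measureMutualInfo_eq_zero_iff {μ : Measure (S × U)} [FiniteSupport μ]
    [IsZeroOrProbabilityMeasure μ] :
    Im[μ] = 0 ↔ ∀ p, μ.real {p} = (μ.map Prod.fst).real {p.1} * (μ.map Prod.snd).real {p.2} :=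
  measureMutualInfo_nonneg_aux.2

end measureMutualInfo

end Literature.Combinatorics.Additive.PFR

end PFR_ForMathlib_Entropy_Measure

/-! ## Port of `PFR/ForMathlib/Uniform.lean` -/
section PFR_ForMathlib_Uniform
open Function MeasureTheory Measure Set
open scoped ENNReal

namespace Literature.Combinatorics.Additive.PFR
open scoped ProbabilityTheory
open ProbabilityTheory
universe uΩ uS uT uU
variable {Ω : Type uΩ} {S : Type uS} {T : Type uT} [mΩ : MeasurableSpace Ω]
  {X : Ω → S} {Y : Ω → T} {μ : Measure Ω} {H : Set S}

/-- The assertion that the law of $X$ is the uniform probability measure on a finite set $H$.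
While in applications $H$ will be non-empty finite set, $X$ measurable, and and $μ$ a probability
measure, it could be technically convenient to have a definition that works even without these
hypotheses. (For instance, `isUniform` would be well-defined, but false, for infinite `H`).

This should probably be refactored, requiring instead that `μ.map X = uniformOn H`. [folklore] -/
structure IsUniform (H : Set S) (X : Ω → S) (μ : Measure Ω := by volume_tac) : Prop where
  eq_of_mem ⦃x⦄ (hx : x ∈ H) ⦃y⦄ (hy : y ∈ H) : μ (X ⁻¹' {x}) = μ (X ⁻¹' {y})
  measure_preimage_compl : μ (X ⁻¹' Hᶜ) = 0

/-- `isUniform_uniformOn`: ported from PFR (`PFR/ForMathlib/Uniform.lean`). [folklore] -/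
lemma isUniform_uniformOn [MeasurableSingletonClass Ω] {A : Set Ω} :
    IsUniform A id (uniformOn A) := by
  constructor
  · intro x hx y hy
    have h'x : {x} ∩ A = {x} := by ext y; simp (config := {contextual := true}) [hx]
    have h'y : {y} ∩ A = {y} := by ext y; simp (config := {contextual := true}) [hy]
    simp [uniformOn, ProbabilityTheory.cond, h'x, h'y]
  · exact uniformOn_apply_eq_zero (by simp)

/-- Uniform distributions exist. [folklore] -/
lemma exists_isUniform [MeasurableSpace S] [MeasurableSingletonClass S]
    (H : Finset S) (h : H.Nonempty) :
    ∃ (Ω : Type uS) (_ : MeasurableSpace Ω) (X : Ω → S) (μ : Measure Ω),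
      IsProbabilityMeasure μ ∧ Measurable X ∧ IsUniform H X μ ∧ (∀ ω, X ω ∈ H) ∧ FiniteRange X := by
  refine ⟨H, Subtype.instMeasurableSpace, fun x ↦ x, (Finset.card H : ℝ≥0∞)⁻¹ • ∑ i, .dirac i, ?_,
    measurable_subtype_coe, ⟨?_, ?_⟩, fun x ↦ x.2, ?_⟩
  · constructor
    simp only [Finset.univ_eq_attach, Measure.smul_apply, Measure.coe_finsetSum, Finset.sum_apply,
      measure_univ, Finset.sum_const, Finset.card_attach, nsmul_eq_mul, mul_one, smul_eq_mul]
    rw [ENNReal.inv_mul_cancel]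
    · simpa using h.ne_empty
    · simp
  · intro x hx y hy
    simp only [Finset.univ_eq_attach, Measure.smul_apply, Measure.coe_finsetSum,
      Finset.sum_apply, Measure.dirac_apply, smul_eq_mul]
    rw [Finset.sum_eq_single ⟨x, hx⟩, Finset.sum_eq_single ⟨y, hy⟩]
    · simp
    · rintro ⟨b, bH⟩ _hb h'b
      simp only [ne_eq, Subtype.mk.injEq] at h'b
      simp [h'b]
    · simp
    · rintro ⟨b, bH⟩ _hb h'b
      simp only [ne_eq, Subtype.mk.injEq] at h'b
      simp [h'b]
    · simp
  · simp
  · apply finiteRange_of_finset _ H _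
    simp

/-- The image of a uniform random variable under an injective map is uniform on the image. [folklore] -/
lemma IsUniform.comp [DecidableEq T] {H : Finset S} (h : IsUniform H X μ) {f : S → T}
    (hf : Injective f) : IsUniform (Finset.image f H) (f ∘ X) μ where
  eq_of_mem := by
    intro x hx y hy
    simp only [Finset.coe_image, mem_image, Finset.mem_coe] at hx hy
    rcases hx with ⟨x, hx, rfl⟩
    rcases hy with ⟨y, hy, rfl⟩
    have A z : f ⁻¹' {f z} = {z} := by ext; simp [hf.eq_iff]
    simp [preimage_comp, A, h.eq_of_mem hx hy]
  measure_preimage_compl := by simpa [preimage_comp, hf] using h.measure_preimage_compl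

/-- Uniform distributions exist, version giving a measure space [folklore] -/
lemma exists_isUniform_measureSpace {S : Type uS} [MeasurableSpace S]
    [MeasurableSingletonClass S] (H : Finset S) (h : H.Nonempty) :
    ∃ (Ω : Type uS) (mΩ : MeasureSpace Ω) (U : Ω → S),
    IsProbabilityMeasure (ℙ : Measure Ω) ∧ Measurable U ∧ IsUniform H U ∧ (∀ ω : Ω, U ω ∈ H) ∧
      FiniteRange U := by
  rcases exists_isUniform H h with ⟨Ω, mΩ, X, μ, hμ, Xmeas, Xunif, Xmem, Xfin⟩
  exact ⟨Ω, ⟨μ⟩, X, hμ, Xmeas, Xunif, Xmem, Xfin⟩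

/-- Uniform distributions exist, version with a Finite set rather than a Finset and giving a measure
space [folklore] -/
lemma exists_isUniform_measureSpace' {S : Type uS} [MeasurableSpace S]
    [MeasurableSingletonClass S] (H : Set S) (hH : H.Finite) (h'H : H.Nonempty) :
    ∃ (Ω : Type uS) (mΩ : MeasureSpace Ω) (U : Ω → S),
    IsProbabilityMeasure (ℙ : Measure Ω) ∧ Measurable U ∧ IsUniform H U
      ∧ (∀ ω, U ω ∈ H) ∧ FiniteRange U := by
  set Hf := hH.toFinset
  have hHf : Hf.Nonempty := by simpa [Hf] using h'H
  obtain ⟨Ω, mΩ, U, hμ, hmes, hunif, hrange, hfin⟩ := exists_isUniform_measureSpace Hf hHf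
  simp only [Finite.coe_toFinset, Finite.mem_toFinset, Hf] at hunif hrange
  exact ⟨Ω, mΩ, U, hμ, hmes, hunif, hrange, hfin⟩

/-- A uniform random variable on H almost surely takes values in H. [folklore] -/
lemma IsUniform.ae_mem (h : IsUniform H X μ) : ∀ᵐ ω ∂μ, X ω ∈ H := h.measure_preimage_compl

/-- Uniform random variables only exist for non-empty sets H. [folklore] -/
lemma IsUniform.nonempty {H : Finset S} (h : IsUniform H X μ) [hμ : NeZero μ] : H.Nonempty := by
  rcases Finset.eq_empty_or_nonempty H with rfl|h'
  · simpa [hμ.out] using h.measure_preimage_compl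
  · exact h'

/-- A "unit test" for the definition of uniform distribution. [folklore] -/
lemma IsUniform.measure_preimage_of_nmem (h : IsUniform H X μ) {s : S} (hs : s ∉ H) :
    μ (X ⁻¹' {s}) = 0 := by
  apply le_antisymm ((measure_mono _).trans h.measure_preimage_compl.le) zero_le
  apply preimage_mono
  simpa using hs

/-- Another "unit test" for the definition of uniform distribution. [folklore] -/
lemma IsUniform.measureReal_preimage_of_nmem (h : IsUniform H X μ) {s : S} (hs : s ∉ H) :
    μ.real (X ⁻¹' {s}) = 0 := by
  rw [measureReal_def, h.measure_preimage_of_nmem hs, ENNReal.toReal_zero]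

variable [MeasurableSpace S] [DiscreteMeasurableSpace S]

/-- A "unit test" for the definition of uniform distribution. [folklore] -/
lemma IsUniform.measure_preimage_of_mem
    {H : Finset S} (h : IsUniform H X μ) (hX : Measurable X)
    {s : S} (hs : s ∈ H) :
    μ (X ⁻¹' {s}) = μ univ / Nat.card H := by
  have B : μ univ = (Nat.card H) * μ (X ⁻¹' {s}) := calc
    μ univ = μ (X ⁻¹' Hᶜ) + μ (X ⁻¹' H) := by
      rw [← measure_union (disjoint_compl_left.preimage _) (hX .of_discrete)]
      simp
    _ = μ (X ⁻¹' H) := by rw [h.measure_preimage_compl, zero_add]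
    _ = ∑ x ∈ H, μ (X ⁻¹' {x}) := by
      have : X ⁻¹' H = ⋃ x ∈ H, X ⁻¹' ({x} : Set S) := by simp
      rw [this, measure_biUnion_finset]
      · intro y _hy z _hz hyz
        apply Disjoint.preimage
        simp [hyz]
      · intro y _hy
        exact hX .of_discrete
    _ = ∑ _x ∈ H, μ (X ⁻¹' {s}) :=
      Finset.sum_congr rfl fun x hx ↦ h.eq_of_mem (by simpa using hx) hs
    _ = H.card * μ (X ⁻¹' {s}) := by simp
    _ = (Nat.card H) * μ (X ⁻¹' {s}) := by
      congr; simp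
  rcases Nat.eq_zero_or_pos (Nat.card H) with hH|hH
  · simp only [hH, CharP.cast_eq_zero, zero_mul, Measure.measure_univ_eq_zero] at B
    simp [B]
  · rwa [eq_comm, ← ENNReal.eq_div_iff] at B
    · simpa using Nat.pos_iff_ne_zero.mp hH
    · simp

/-- A "unit test" for the definition of uniform distribution. [folklore] -/
lemma IsUniform.measureReal_preimage_of_mem {A : Finset S} [IsProbabilityMeasure μ]
    (h : IsUniform A X μ) (hX : Measurable X) {s : S} (hs : s ∈ A) :
    μ.real (X ⁻¹' {s}) = 1 / A.card := by
  simp [measureReal_def, h.measure_preimage_of_mem hX hs]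

/-- `IsUniform.measureReal_preimage_of_mem'`: ported from PFR (`PFR/ForMathlib/Uniform.lean`). [folklore] -/
lemma IsUniform.measureReal_preimage_of_mem' {A : Finset S} [IsProbabilityMeasure μ]
    (h : IsUniform A X μ) (hX : Measurable X) {s : S} (hs : s ∈ A) :
    (μ.map X).real {s} = 1 / A.card := by
  rw [map_measureReal_apply hX (MeasurableSet.singleton s), h.measureReal_preimage_of_mem hX hs]

/-- $\mathbb{P}(U_H \in H') = \dfrac{|H' \cap H|}{|H|}$ [folklore] -/
lemma IsUniform.measure_preimage {H : Finset S} (h : IsUniform H X μ) (hX : Measurable X)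
    (H' : Set S) : μ (X ⁻¹' H') = (μ univ) * (Nat.card (H' ∩ H : Set S)) / Nat.card H := calc
  _ = μ (X ⁻¹' (H' ∩ H) ∪ X ⁻¹' (H' \ H)) := by simp
  _ = μ (X ⁻¹' (H' ∩ H)) + μ (X ⁻¹' (H' \ H)) :=
    measure_union (Disjoint.preimage X disjoint_inf_sdiff) (by measurability)
  _ = μ (X ⁻¹' (H' ∩ H).toFinite.toFinset) := by
    simp [Set.sdiff_eq_compl_inter, measure_mono_null inter_subset_left h.measure_preimage_compl,
      -preimage_compl]
  _ = μ univ * ∑ __ ∈ (H' ∩ H).toFinite.toFinset, (1 : ENNReal) / Nat.card H := by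
    rewrite [← sum_measure_preimage_singleton _ (by measurability), Finset.mul_sum]
    refine Finset.sum_congr rfl (fun _ hx ↦ ?_)
    rw [mul_one_div, h.measure_preimage_of_mem hX ((Finite.mem_toFinset _).mp hx).2]
  _ = (μ univ) * (Nat.card (H' ∩ H).Elem) / Nat.card H := by
    rw [Finset.sum_const, Nat.card_eq_card_finite_toFinset, nsmul_eq_mul, ← mul_assoc, mul_one_div]

/-- $\mathbb{P}(U_H \in H') = \dfrac{|H' \cap H|}{|H|}$ [folklore] -/
lemma IsUniform.measureReal_preimage {H : Finset S} (h : IsUniform H X μ) (hX : Measurable X)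
    (H' : Set S) :
    μ.real (X ⁻¹' H') = (μ.real univ) * (Nat.card (H' ∩ H).Elem) / Nat.card H := by
  simp [measureReal_def, h.measure_preimage hX H', ENNReal.toReal_div]

/-- `IsUniform.nonempty_preimage_of_mem`: ported from PFR (`PFR/ForMathlib/Uniform.lean`). [folklore] -/
lemma IsUniform.nonempty_preimage_of_mem [NeZero μ] {H : Finset S} (h : IsUniform H X μ)
    (hX : Measurable X) {s : S} (hs : s ∈ H) : Set.Nonempty (X ⁻¹' {s}) := by
  apply MeasureTheory.nonempty_of_measure_ne_zero
  rewrite [h.measure_preimage_of_mem hX hs]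
  simp [NeZero.ne]

/-- `IsUniform.full_measure`: ported from PFR (`PFR/ForMathlib/Uniform.lean`). [folklore] -/
lemma IsUniform.full_measure (h : IsUniform H X μ) (hX : Measurable X) :
    (μ.map X) H = μ Set.univ := by
    rw [Measure.map_apply hX (by measurability)]
    refine measure_eq_measure_of_null_sdiff (subset_univ _) ?h_nulldiff
    convert h.measure_preimage_compl
    ext ω; simp

/-- A copy of a uniform random variable is also uniform. [folklore] -/
lemma IsUniform.of_identDistrib {Ω' : Type*} [MeasurableSpace Ω'] (h : IsUniform H X μ)
    {X' : Ω' → S} {μ' : Measure Ω'} (h' : IdentDistrib X X' μ μ') (hH : MeasurableSet (H : Set S)) :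
    IsUniform H X' μ' := by
  constructor
  · intro x hx y hy
    rw [← h'.measure_mem_eq (MeasurableSet.singleton x),
      ← h'.measure_mem_eq (MeasurableSet.singleton y)]
    apply h.eq_of_mem hx hy
  · rw [← h'.measure_mem_eq hH.compl]
    exact h.measure_preimage_compl

/-- $\mathbb{P}(U_H \in H') \neq 0$ if $H'$ intersects $H$ and the measure is non-zero. [folklore] -/
lemma IsUniform.measure_preimage_ne_zero {H : Finset S} [NeZero μ] (h : IsUniform H X μ)
    (hX : Measurable X) {H' : Set S} (h' : (H' ∩ H).Nonempty) : μ (X ⁻¹' H') ≠ 0 := by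
  simpa [h.measure_preimage hX H', NeZero.ne, Set.ncard_eq_zero (H.finite_toSet.inter_of_right _)]

/-- If $X$ is uniform w.r.t. $\mu$ on $H$, then $X$ is uniform w.r.t. $\mu$ conditioned by
$H'$ on $H' \cap H$. [folklore] -/
lemma IsUniform.restrict {H : Set S} (h : IsUniform H X μ) (hX : Measurable X) (H' : Set S) :
    IsUniform (H' ∩ H) X (μ[|X ⁻¹' H']) where
  eq_of_mem := fun x hx y hy ↦ by
    simp only [ProbabilityTheory.cond, Measure.smul_apply, smul_eq_mul]
    rw [μ.restrict_eq_self (preimage_mono (singleton_subset_iff.mpr hx.1)),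
      μ.restrict_eq_self (preimage_mono (singleton_subset_iff.mpr hy.1)), h.eq_of_mem hx.2 hy.2]
  measure_preimage_compl := by
    rewrite [← nonpos_iff_eq_zero, Set.compl_inter, Set.preimage_union]
    calc
      _ ≤ (μ[|X ⁻¹' H']) (X ⁻¹' H'ᶜ) + (μ[|X ⁻¹' H']) (X ⁻¹' Hᶜ) := measure_union_le _ _
      _ = (μ[|X ⁻¹' H']) (X ⁻¹' H'ᶜ) + 0 := congrArg _ <| by
        simp only [ProbabilityTheory.cond, Measure.smul_apply, smul_eq_mul]
        convert mul_zero _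
        exact eq_bot_mono (Measure.restrict_apply_le _ _) h.measure_preimage_compl
      _ = 0 := by
        simp only [ProbabilityTheory.cond, Measure.smul_apply, smul_eq_mul]
        rw [add_zero, Set.preimage_compl, Measure.restrict_apply <|
          MeasurableSet.compl (measurableSet_preimage hX .of_discrete),
          compl_inter_self, measure_empty, mul_zero]

open ProbabilityTheory.IdentDistrib in
/-- `_root_.ProbabilityTheory.IdentDistrib.of_isUniform`: ported from PFR (`PFR/ForMathlib/Uniform.lean`). [folklore] -/
lemma _root_.ProbabilityTheory.IdentDistrib.of_isUniform {Ω' : Type*} [MeasurableSpace Ω'] {μ' : Measure Ω'}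
    [IsProbabilityMeasure μ] [IsProbabilityMeasure μ'] [Finite H] [Countable S]
    {X : Ω → S} {X' : Ω' → S}
    (hX : Measurable X) (hX' : Measurable X') (hX_unif : IsUniform H X μ)
    (hX'_unif : IsUniform H X' μ') : IdentDistrib X X' μ μ' := by
  refine ⟨hX.aemeasurable, hX'.aemeasurable, ?_⟩
  ext E hE
  rw [← MeasureTheory.Measure.tsum_indicator_apply_singleton _ _ hE,
    ← MeasureTheory.Measure.tsum_indicator_apply_singleton _ _ hE]
  congr! 4 with _ x
  rw [Measure.map_apply hX (.singleton x), Measure.map_apply hX' (.singleton x)]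
  set Hf := H.toFinite.toFinset
  have hX_unif' : IsUniform Hf X μ := by convert hX_unif; simp [Hf]
  have hX'_unif' : IsUniform Hf X' μ' := by convert hX'_unif; simp [Hf]
  by_cases h : x ∈ Hf
  · rw [IsUniform.measure_preimage_of_mem hX_unif' hX h,
      IsUniform.measure_preimage_of_mem hX'_unif' hX' h]
    simp
  · rw [IsUniform.measure_preimage_of_nmem hX_unif' h,
      IsUniform.measure_preimage_of_nmem hX'_unif' h]

/-- `IsUniform.map_eq_uniformOn`: ported from PFR (`PFR/ForMathlib/Uniform.lean`). [folklore] -/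
lemma IsUniform.map_eq_uniformOn [Countable S] [IsProbabilityMeasure μ]
    {H : Set S} (h : IsUniform H X μ) (hX : Measurable X) (hH : H.Finite) (h'H : H.Nonempty) :
    μ.map X = uniformOn H := by
  have : Finite H := hH
  have : IsProbabilityMeasure (uniformOn H) := isProbabilityMeasure_uniformOn hH h'H
  have : IdentDistrib X id μ (uniformOn (H : Set S)) :=
    .of_isUniform (H := H) hX measurable_id h isUniform_uniformOn
  simpa using this.map_eq

/-- A random variable is uniform iff its distribution is. [folklore] -/
lemma isUniform_iff_map_eq_uniformOn [Finite H] {Ω : Type*} [mΩ : MeasurableSpace Ω] (μ : Measure Ω)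
    [Countable S] [IsProbabilityMeasure μ] {U : Ω → S} (hU : Measurable U) :
    IsUniform H U μ ↔ μ.map U = uniformOn H := by
  constructor
  · intro h_unif
    ext A hA
    let Hf := H.toFinite.toFinset
    have h_unif': IsUniform Hf U μ := (Set.Finite.coe_toFinset H.toFinite).symm ▸ h_unif
    let AHf := (A ∩ H).toFinite.toFinset
    rw [uniformOn_apply ‹_›, ← MeasureTheory.Measure.tsum_indicator_apply_singleton _ _ hA]
    classical
    calc ∑' x, Set.indicator A (fun x => (μ.map U) {x}) x
      _ = ∑' x, (if x ∈ (A ∩ H) then (1:ENNReal) / (Nat.card H) else 0) := by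
        congr with x
        by_cases h : x ∈ A
        · by_cases h' : x ∈ H <;>
            simp [h, h', Hf, h_unif'.measure_preimage_of_mem hU, h_unif'.measure_preimage_of_nmem,
              map_apply hU (MeasurableSet.singleton x)]
        · simp [h]
      _ = Finset.sum AHf (fun _ ↦ (1:ENNReal) / (Nat.card H)) := by
        rw [tsum_eq_sum (s := (A ∩ H).toFinite.toFinset)]
        · apply Finset.sum_congr (by rfl)
          intro x hx
          simp only [Set.Finite.mem_toFinset, Set.mem_inter_iff, AHf] at hx
          simp [hx]
        intro x hx
        simp at hx
        simpa
      _ = Nat.card ↑(H ∩ A) / Nat.card H := by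
        simp [Finset.sum_const, Set.inter_comm, AHf, ← Nat.card_eq_card_finite_toFinset]
        rfl
  intro this
  constructor
  · intro x hx y hy
    replace hx : {x} ∩ H = {x} := by simp [hx]
    replace hy : {y} ∩ H = {y} := by simp [hy]
    simp [← map_apply hU (MeasurableSet.singleton _), this, uniformOn_apply, hx, hy, Set.toFinite,
      Set.inter_comm H]
  · rw [← map_apply hU (by measurability), this, uniformOn_apply ‹_›]
    simp

end Literature.Combinatorics.Additive.PFR

end PFR_ForMathlib_Uniform
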